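import Summits.CriticalPhenomena.SAWScalingLimit.Theorems.SAWLoopFugacityFlowAvoidanceLimitGreenConvergenceBridge
import Summits.CriticalPhenomena.SAWScalingLimit.Theorems.SAWLoopFugacityFlowAvoidanceLimitGreenConvergenceComponent
import Summits.CriticalPhenomena.SAWScalingLimit.Theorems.SAWLoopFugacityFlowAvoidanceLimitGreenConvergenceInnerHoleFree
import Summits.CriticalPhenomena.SAWScalingLimit.Theorems.SAWLoopFugacityFlowAvoidanceLimitGreenConvergenceOuterFill
import Summits.CriticalPhenomena.SAWScalingLimit.Theorems.SAWLoopFugacityFlowAvoidanceLimitGreenConvergenceOuterKernel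
import Summits.CriticalPhenomena.SAWScalingLimit.Theorems.SAWLoopFugacityFlowAvoidanceLimitExcursionRatioWalkSum
import Literature.Probability.LatticeModels.KilledGreenMonotone

/-!
# The lattice sandwich for GC: edge-killed confined Green's function between two site-killed ones
— helper file of stub `stub_greenConvergence` (GC) of line `symplectic-fermion-anchor`
(crux `SAWLoopFugacityFlow.AvoidanceLimit`, stmt-CriticalPhenomena-10649; lead c2 GC-sandwich programme)

GC (interior convergence of the Green's function of the CONFINED walk — simple random walk of
`Ω_δ(D)` killed when it uses an edge whose closed segment leaves `closure D'`, i.e. the matrix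
Green's function `greenEntry (confinedGraph D D' δ) (meshDomainFinset D δ)`) is reduced by the lead
to the printed Chelkak–Wan theorem (`killedGreen_tendsto_of_kernelConvergence`, SITE-killed walks on
hole-free induced lattice domains) through the pointwise sandwich proved here:

* `killedGreen_inner_le_greenEntry` — for the INNER approximant (the `siteGraph`-component `C⁻` of a
  base site in the set of bulk sites `x ∈ meshDomain D δ` with `closedBall(δx, 2δ) ⊆ D'`), and `u, v`
  in that component: `G_{siteGraph C⁻}(u,v) ≤ greenEntry (confinedGraph D D' δ) (meshDomainFinset D δ) u v`
  (the induced walk on `C⁻` is a confined walk: `siteGraph_inner_le_confinedGraph`, the component lemma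
  `killedGreen_siteGraph_eq_killedGreen_siteGraph_reachable`, monotonicity `SRW.killedGreen_mono`, and
  the bridge `greenEntry_eq_killedGreen`);
* `greenEntry_le_killedGreen_outer` — for the OUTER approximant (the `siteGraph`-component `C⁺` of a base
  site in the hole-fill `NE_δ` of `V'_δ = {x | δx ∈ closure D'}`) and `u` in that component:
  `greenEntry (confinedGraph D D' δ) (meshDomainFinset D δ) u v ≤ G_{siteGraph C⁺}(u,v)` (a confined edge
  joins two sites of `V'_δ ⊆ NE_δ`: `confinedGraph_le_siteGraph_nonEscaping`; `NE_δ` is finite: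
  `nonEscaping_subset_box`).

Sources: G. F. Lawler, *Intersections of Random Walks* (1991) §1.5 (`G_A ≤ G_B` for `A ⊆ B`)
[Lawler1991]; D. Chelkak, Y. Wan (2021) §2.1 [ChelkakWan2021] for the site-killed walk `Z_{Ω^δ}`.
No definitions, nothing from the literature is asserted.
-/

noncomputable section

open scoped BigOperators Topology
open Filter Finset
open Literature.Probability.RandomPlanarGeometry Literature.Probability.LatticeModels

namespace Summit.CriticalPhenomena.SAWScalingLimit.Theorems.AvoidanceLimit.Anchor

/-! ## Reachability classes -/

/-- Two mutually reachable sites have the same reachability class. [folklore] -/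
theorem setOf_reachable_eq_of_reachable {G : SimpleGraph (Site 2)} {b u : Site 2} (h : G.Reachable b u) :
    {x : Site 2 | G.Reachable u x} = {x : Site 2 | G.Reachable b x} :=
  Set.ext fun _ => ⟨fun hx => h.trans hx, fun hx => h.symm.trans hx⟩

/-- The reachability class of a site of `A` in `siteGraph A` lies in `A`. [folklore] -/
theorem setOf_siteGraph_reachable_subset {A : Set (Site 2)} {b : Site 2} (hb : b ∈ A) :
    {x : Site 2 | (ChordalLERW.siteGraph A).Reachable b x} ⊆ A :=
  fun _ hx => InnerKernel.mem_of_siteGraph_reachable hb hx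

/-- The support of `siteGraph A` lies in `A`. [folklore] -/
theorem support_siteGraph_subset (A : Set (Site 2)) : (ChordalLERW.siteGraph A).support ⊆ A := by
  intro x hx
  obtain ⟨y, hy⟩ := (SimpleGraph.mem_support _).1 hx
  exact (ChordalLERW.siteGraph_adj_iff.1 hy).2.1

/-! ## Lower half: the inner induced walk is a confined walk -/

/-- **Lower sandwich.** For `δ > 0`, `D' ⊆ D`, a base site `b` in the inner set
`Inner = {y ∈ meshDomain D δ | closedBall(δy, 2δ) ⊆ D'}` and two sites `u, v` of the
`siteGraph Inner`-component `C⁻` of `b`: the Green's function of simple random walk killed on leaving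
`C⁻` is at most the confined matrix Green's function,
`G_{siteGraph C⁻}(u, v) ≤ greenEntry (confinedGraph D D' δ) (meshDomainFinset D δ) u v`.
[cite: Lawler1991, §1.5] -/
theorem killedGreen_inner_le_greenEntry :
    ∀ (D D' : JordanDomain) (δ : ℝ) (b u v : Site 2), 0 < δ → D'.carrier ⊆ D.carrier →
      b ∈ {y : Site 2 | y ∈ meshDomain D.carrier δ ∧
        Metric.closedBall (meshPoint δ y) (2 * δ) ⊆ D'.carrier} →
      (ChordalLERW.siteGraph {y : Site 2 | y ∈ meshDomain D.carrier δ ∧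
        Metric.closedBall (meshPoint δ y) (2 * δ) ⊆ D'.carrier}).Reachable b u →
      (ChordalLERW.siteGraph {y : Site 2 | y ∈ meshDomain D.carrier δ ∧
        Metric.closedBall (meshPoint δ y) (2 * δ) ⊆ D'.carrier}).Reachable b v →
      SRW.killedGreen (ChordalLERW.siteGraph {x : Site 2 |
        (ChordalLERW.siteGraph {y : Site 2 | y ∈ meshDomain D.carrier δ ∧
          Metric.closedBall (meshPoint δ y) (2 * δ) ⊆ D'.carrier}).Reachable b x}) u v ≤
        greenEntry (confinedGraph D.carrier D'.carrier δ) (meshDomainFinset D.carrier δ) u v := by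
  intro D D' δ b u v hδ hsub hb hu hv
  set Inner : Set (Site 2) := {y : Site 2 | y ∈ meshDomain D.carrier δ ∧
    Metric.closedBall (meshPoint δ y) (2 * δ) ⊆ D'.carrier} with hInner
  have huI : u ∈ Inner := InnerKernel.mem_of_siteGraph_reachable hb hu
  have hvI : v ∈ Inner := InnerKernel.mem_of_siteGraph_reachable hb hv
  have hΛ : ∀ x : Site 2, x ∈ Inner → x ∈ meshDomainFinset D.carrier δ := fun x hx => by
    rw [← Finset.mem_coe, coe_meshDomainFinset D.isBounded hδ]
    exact hx.1
  -- the class of `b` is the class of `u`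
  rw [← setOf_reachable_eq_of_reachable hu, ← killedGreen_siteGraph_eq_killedGreen_siteGraph_reachable]
  -- bridge on the confined side
  have hK : confinedGraph D.carrier D'.carrier δ ≤ zdGraph 2 := confinedGraph_le_zdGraph _ _ δ
  rw [greenEntry_eq_killedGreen (confinedGraph D.carrier D'.carrier δ) (meshDomainFinset D.carrier δ) u v hK
    (fun x y h => confined_adj_mem_meshDomainFinset D.isBounded hδ h) (hΛ u huI) (hΛ v hvI)]
  -- monotonicity in the graph
  have hfin : (confinedGraph D.carrier D'.carrier δ).support.Finite :=
    (meshDomain_finite D.isBounded hδ).subset fun x hx => by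
      obtain ⟨y, hy⟩ := (SimpleGraph.mem_support _).1 hx
      exact (discreteDomainGraph_adj_iff.1 (confinedGraph_le _ _ δ hy)).2.1
  exact SRW.killedGreen_mono (siteGraph_inner_le_confinedGraph D D' δ hδ hsub) hfin u v

/-! ## Upper half: a confined walk is a walk of the hole-filled closed-domain sites -/

/-- A confined edge joins two sites whose mesh points lie in `closure D'`, hence two sites of the
hole-fill `NE_δ` of `V'_δ = {w | δw ∈ closure D'}`. [folklore] -/
theorem confinedGraph_le_siteGraph_nonEscaping (D D' : Set ℂ) (δ : ℝ) :
    confinedGraph D D' δ ≤ ChordalLERW.siteGraph {g : Site 2 | ¬ ∀ M : ℤ, ∃ g' : Site 2, M ≤ g' 1 ∧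
      Relation.ReflTransGen (FaceStep {w : Site 2 | meshPoint δ w ∈ closure D'}) g g'} := by
  intro x y hxy
  have hxy' := hxy
  rw [confinedGraph, SimpleGraph.fromRel_adj] at hxy'
  obtain ⟨-, h | h⟩ := hxy'
  · refine ChordalLERW.siteGraph_adj_iff.2 ⟨?_, ?_, ?_⟩
    · exact meshGraph_le_zdGraph D δ (discreteDomainGraph_le_meshGraph D δ h.1)
    · exact OuterKernel.not_escaping_of_mem (h.2 (left_mem_segment ℝ _ _))
    · exact OuterKernel.not_escaping_of_mem (h.2 (right_mem_segment ℝ _ _))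
  · refine ChordalLERW.siteGraph_adj_iff.2 ⟨?_, ?_, ?_⟩
    · exact (meshGraph_le_zdGraph D δ (discreteDomainGraph_le_meshGraph D δ h.1)).symm
    · exact OuterKernel.not_escaping_of_mem (h.2 (right_mem_segment ℝ _ _))
    · exact OuterKernel.not_escaping_of_mem (h.2 (left_mem_segment ℝ _ _))

/-- The sites of the closed domain lie in a lattice box: if `closure D' ⊆ closedBall 0 R₀` and
`δ > 0` then every `w` with `δw ∈ closure D'` has `|w 0|, |w 1| ≤ ⌈R₀/δ⌉₊`. [folklore] -/
theorem abs_le_of_meshPoint_mem {D' : Set ℂ} {δ R₀ : ℝ} (hδ : 0 < δ)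
    (hR : closure D' ⊆ Metric.closedBall (0 : ℂ) R₀) {w : Site 2} (hw : meshPoint δ w ∈ closure D') :
    |w 0| ≤ (⌈R₀ / δ⌉₊ : ℕ) ∧ |w 1| ≤ (⌈R₀ / δ⌉₊ : ℕ) := by
  have hn : ‖meshPoint δ w‖ ≤ R₀ := by simpa using hR hw
  have h0 : |(meshPoint δ w).re| ≤ R₀ := (Complex.abs_re_le_norm _).trans hn
  have h1 : |(meshPoint δ w).im| ≤ R₀ := (Complex.abs_im_le_norm _).trans hn
  rw [meshPoint_re, abs_mul, abs_of_pos hδ] at h0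
  rw [meshPoint_im, abs_mul, abs_of_pos hδ] at h1
  have key : ∀ a : ℤ, δ * |(a : ℝ)| ≤ R₀ → |a| ≤ ((⌈R₀ / δ⌉₊ : ℕ) : ℤ) := fun a ha => by
    have ha' : |(a : ℝ)| ≤ R₀ / δ := by rw [le_div_iff₀ hδ, mul_comm]; exact ha
    have h2 : (R₀ / δ : ℝ) ≤ (⌈R₀ / δ⌉₊ : ℕ) := Nat.le_ceil _
    have h3 : |(a : ℝ)| ≤ ((⌈R₀ / δ⌉₊ : ℕ) : ℝ) := ha'.trans h2
    have h4 : ((|a| : ℤ) : ℝ) ≤ (((⌈R₀ / δ⌉₊ : ℕ) : ℤ) : ℝ) := by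
      rw [Int.cast_abs]; exact_mod_cast h3
    exact_mod_cast h4
  exact ⟨key _ h0, key _ h1⟩

/-- The hole-fill `NE_δ` of the closed-domain sites of a bounded `D'` is finite (`δ > 0`): it lies in
the lattice box of `V'_δ` (`nonEscaping_subset_box`). [folklore] -/
theorem finite_nonEscaping {D' : Set ℂ} (hD' : Bornology.IsBounded D') {δ : ℝ} (hδ : 0 < δ) :
    {g : Site 2 | ¬ ∀ M : ℤ, ∃ g' : Site 2, M ≤ g' 1 ∧
      Relation.ReflTransGen (FaceStep {w : Site 2 | meshPoint δ w ∈ closure D'}) g g'}.Finite := by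
  obtain ⟨R₀, hR⟩ := (Metric.isBounded_iff_subset_closedBall (0 : ℂ)).1 hD'.closure
  set N : ℕ := ⌈R₀ / δ⌉₊ with hN
  have hbox := nonEscaping_subset_box {w : Site 2 | meshPoint δ w ∈ closure D'} N
    (fun v hv => abs_le_of_meshPoint_mem hδ hR hv)
  refine Set.Finite.subset ?_ hbox
  have hfin : (Set.Icc (-(N : ℤ)) N ×ˢ Set.Icc (-(N : ℤ)) N).Finite :=
    (Set.finite_Icc _ _).prod (Set.finite_Icc _ _)
  refine (hfin.image fun p : ℤ × ℤ => (![p.1, p.2] : Site 2)).subset ?_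
  intro g hg
  refine ⟨(g 0, g 1), ⟨abs_le.1 hg.1, abs_le.1 hg.2⟩, ?_⟩
  ext i
  fin_cases i <;> rfl

/-- **Upper sandwich.** For `δ > 0`, bounded `D`, and a site `u` of the `siteGraph NE_δ`-component
`C⁺` of a base site `b`, where `NE_δ` is the hole-fill of `{w | δw ∈ closure D'}` (`D'` bounded):
`greenEntry (confinedGraph D D' δ) (meshDomainFinset D δ) u v ≤ G_{siteGraph C⁺}(u, v)`.
[cite: Lawler1991, §1.5] -/
theorem greenEntry_le_killedGreen_outer :
    ∀ (D D' : Set ℂ) (δ : ℝ) (b u v : Site 2), Bornology.IsBounded D → Bornology.IsBounded D' → 0 < δ →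
      (ChordalLERW.siteGraph {g : Site 2 | ¬ ∀ M : ℤ, ∃ g' : Site 2, M ≤ g' 1 ∧
        Relation.ReflTransGen (FaceStep {w : Site 2 | meshPoint δ w ∈ closure D'}) g g'}).Reachable b u →
      greenEntry (confinedGraph D D' δ) (meshDomainFinset D δ) u v ≤
        SRW.killedGreen (ChordalLERW.siteGraph {x : Site 2 |
          (ChordalLERW.siteGraph {g : Site 2 | ¬ ∀ M : ℤ, ∃ g' : Site 2, M ≤ g' 1 ∧
            Relation.ReflTransGen (FaceStep {w : Site 2 | meshPoint δ w ∈ closure D'}) g g'}).Reachable b x})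
          u v := by
  intro D D' δ b u v hD hD' hδ hu
  set NE : Set (Site 2) := {g : Site 2 | ¬ ∀ M : ℤ, ∃ g' : Site 2, M ≤ g' 1 ∧
    Relation.ReflTransGen (FaceStep {w : Site 2 | meshPoint δ w ∈ closure D'}) g g'} with hNE
  rw [← setOf_reachable_eq_of_reachable hu, ← killedGreen_siteGraph_eq_killedGreen_siteGraph_reachable]
  have hK : confinedGraph D D' δ ≤ zdGraph 2 := confinedGraph_le_zdGraph _ _ δ
  -- `greenEntry ≤ killedGreen` on the confined graph (equality inside the volume, junk `0` outside)
  have h1 : greenEntry (confinedGraph D D' δ) (meshDomainFinset D δ) u v ≤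
      SRW.killedGreen (confinedGraph D D' δ) u v := by
    by_cases huv : u ∈ meshDomainFinset D δ ∧ v ∈ meshDomainFinset D δ
    · exact (greenEntry_eq_killedGreen _ _ u v hK
        (fun x y h => confined_adj_mem_meshDomainFinset hD hδ h) huv.1 huv.2).le
    · rw [greenEntry_of_not _ huv]
      exact SRW.killedGreen_nonneg _ u v
  refine h1.trans ?_
  have hfin : (ChordalLERW.siteGraph NE).support.Finite :=
    (finite_nonEscaping hD' hδ).subset (support_siteGraph_subset NE)
  exact SRW.killedGreen_mono (confinedGraph_le_siteGraph_nonEscaping D D' δ) hfin u v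

end Summit.CriticalPhenomena.SAWScalingLimit.Theorems.AvoidanceLimit.Anchor

end
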